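import Literature.Probability.RandomPlanarGeometry.ConformalRestrictionThreeLeaves
import Literature.Probability.RandomPlanarGeometry.ChordalPathFill
import HarnessLib

/-!
# [LSW] p. 5 result 2, uniqueness (`LawlerSchrammWerner2003_unique`), from ANY `P_1` / from Prop. 4.1

Proof-only glue (no definition, no named fact) for the named fact
`Literature.Probability.RandomPlanarGeometry.LawlerSchrammWerner2003_unique`
(`ConformalRestrictionProofs`: two chordal, conformally covariant, hull-restriction families
carried by simple curves agree in every Dobrushin domain), after

* G. F. Lawler, O. Schramm, W. Werner, *Conformal restriction: the chordal case*, J. Amer. Math.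
  Soc. **16** (2003) 917–955, arXiv:math/0209343 (**[LSW]**, arXiv page numbers), p. 5 result 2:
  "The only measure `P_α` that is supported on simple curves is `P_{5/8}`. It is the law of
  chordal SLE_{8/3}" (Lemma 3.2 p. 10, Prop. 3.3 pp. 10–13, Thm. 7.3 p. 29, Cor. 8.6 pp. 37–38),
  and §4 Prop. 4.1 (p. 16, Virág): "For all `A ∈ 𝒬*`, `P[B[0, ∞) ∩ A = ∅] = Φ'_A(0)`" for the
  Brownian excursion `B`, with "We have just proved that the two-sided restriction measure `P_1`
  exists" (p. 17).

State of the tree (2026-08-15). The uniqueness fact is `…_unique_of_five_eighths` applied to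
`IsRestrictionMeasure.eq_five_eighths_of_outer_simple` (`ConformalRestrictionThreeLeaves`, the
Loewner slit theorem being proved), and that input now follows from the EXISTENCE of one
two-sided restriction measure of exponent `1` alone
(`IsRestrictionMeasure.eq_five_eighths_of_outer_simple_of_exists_one`,
`OneSidedExcursionCloudInterior`: `P⁺_β` for every `β > 0` as the left-filled Poissonian cloud
of hung `P_1`-samples, its interior positivity, Cor. 8.6, `q(5/8) = 1/2`), while `P_1` itself
is the law of the filling of any random path from `0` to `∞` in `ℍ` avoiding each `A ∈ 𝒬*`
with probability `Φ'_A(0)` (`exists_isRestrictionMeasure_of_chordalPath`, `ChordalPathFill`) —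
in [LSW] the Brownian excursion (Prop. 4.1), the one input not yet in the tree. This file
records the two resulting one-step reductions of the uniqueness fact, next to the existing ones
of `LawlerSchrammWerner2003` (`LawlerSchrammWerner2003_of_exists_one`,
`LawlerSchrammWerner2003_of_chordalPath`), so that BOTH p. 5 result 2 facts are discharged by
the same term the moment either input lands:

* `LawlerSchrammWerner2003_unique_of_exists_one` — from `∃ P, IsRestrictionMeasure 1 P`;
* `LawlerSchrammWerner2003_unique_of_chordalPath` — from Prop. 4.1 in the form consumed by
  `ChordalPathFill` (a random path, a.s. chordal, a.e.-measurable rational-time marginals,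
  `ℙ[B[0, ∞) ∩ A = ∅] = Φ'_A(0)` for `A ∈ 𝒬*`);
* `LawlerSchrammWerner2003_and_unique_of_exists_one`, `…_of_chordalPath` — both facts at once.

So `LawlerSchrammWerner2003_unique_holds` is `LawlerSchrammWerner2003_unique_of_exists_one h`
for any proof `h : ∃ P, IsRestrictionMeasure 1 P` (equivalently `…_of_five_eighths
IsRestrictionMeasure.eq_five_eighths_of_outer_simple_holds`).

## References

* [LSW] p. 5 result 2; Lemma 3.2, Prop. 3.3, §4 Prop. 4.1 (pp. 16–17), Thm. 6.1, Cor. 8.6.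
  [LawlerSchrammWerner2003Restriction]
* G. F. Lawler, *Conformally Invariant Processes in the Plane*, AMS (2005), §9.2 Prop. 9.13,
  Cor. 9.11 (pp. 219–220). [Lawler2005]
-/

noncomputable section

open Set MeasureTheory
open UpperHalfPlane (upperHalfPlaneSet)
open scoped NNReal

namespace Literature.Probability.RandomPlanarGeometry

/-- **[LSW] p. 5 result 2, uniqueness, from ANY two-sided restriction measure of exponent `1`**:
`α = 5/8` for simple-curve-supported `P_α` by the one-sided route
(`IsRestrictionMeasure.eq_five_eighths_of_outer_simple_of_exists_one`), then Prop. 3.3 +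
Lemma 3.2 + the Loewner slit theorem (`LawlerSchrammWerner2003_unique_of_five_eighths`).
[cite: LawlerSchrammWerner2003Restriction, p. 5 result 2; Prop. 3.3, Lemma 3.2, Cor. 8.6, §8.1–8.2] -/
theorem LawlerSchrammWerner2003_unique_of_exists_one
    (h1 : ∃ P : Measure RestrictionConfig, IsRestrictionMeasure 1 P) :
    LawlerSchrammWerner2003_unique :=
  LawlerSchrammWerner2003_unique_of_five_eighths
    (IsRestrictionMeasure.eq_five_eighths_of_outer_simple_of_exists_one h1)

/-- **Both p. 5 result 2 facts (`LawlerSchrammWerner2003`, `LawlerSchrammWerner2003_unique`)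
from ANY `P_1`.** [cite: LawlerSchrammWerner2003Restriction, p. 5 result 2] -/
theorem LawlerSchrammWerner2003_and_unique_of_exists_one
    (h1 : ∃ P : Measure RestrictionConfig, IsRestrictionMeasure 1 P) :
    LawlerSchrammWerner2003 ∧ LawlerSchrammWerner2003_unique :=
  ⟨LawlerSchrammWerner2003_of_exists_one h1, LawlerSchrammWerner2003_unique_of_exists_one h1⟩

/-- **[LSW] p. 5 result 2, uniqueness, from Prop. 4.1** in the form: some probability space
carries a random path which is almost surely a path from `0` to `∞` in `ℍ`, with a.e.-measurable
rational-time marginals, and `ℙ[B[0, ∞) ∩ A = ∅] = Φ'_A(0)` for all `A ∈ 𝒬*` — in [LSW] the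
Brownian excursion (Prop. 4.1, Virág); its filling has law `P_1`
(`exists_isRestrictionMeasure_of_chordalPath`).
[cite: LawlerSchrammWerner2003Restriction, §4 Prop. 4.1 (p. 16) with p. 5 result 2] -/
theorem LawlerSchrammWerner2003_unique_of_chordalPath {Ω' : Type*} [MeasurableSpace Ω']
    {ℙ : Measure Ω'} [IsProbabilityMeasure ℙ] {B : Ω' → ℝ≥0 → ℂ}
    (hpath : ∀ᵐ ω ∂ℙ, IsChordalPath (B ω))
    (hmk : ∀ q : ℚ, AEMeasurable (fun ω ↦ B ω (Real.toNNReal q)) ℙ)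
    (h41 : ∀ {A : Set ℂ}, IsStarHull A →
      ∀ {Φ : ConformalEquiv (upperHalfPlaneSet \ A) upperHalfPlaneSet}, IsRestrictionMap A Φ →
        ∀ {d : ℝ}, HasRestrictionDeriv A Φ d →
          ℙ {ω | Disjoint (range (B ω)) A} = ENNReal.ofReal d) :
    LawlerSchrammWerner2003_unique :=
  LawlerSchrammWerner2003_unique_of_exists_one
    (exists_isRestrictionMeasure_of_chordalPath hpath hmk (α := 1) fun hA _ hΦ _ hd ↦ by
      rw [Real.rpow_one]; exact h41 hA hΦ hd)

/-- **Both p. 5 result 2 facts from Prop. 4.1** (same form).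
[cite: LawlerSchrammWerner2003Restriction, §4 Prop. 4.1 (p. 16) with p. 5 result 2] -/
theorem LawlerSchrammWerner2003_and_unique_of_chordalPath {Ω' : Type*} [MeasurableSpace Ω']
    {ℙ : Measure Ω'} [IsProbabilityMeasure ℙ] {B : Ω' → ℝ≥0 → ℂ}
    (hpath : ∀ᵐ ω ∂ℙ, IsChordalPath (B ω))
    (hmk : ∀ q : ℚ, AEMeasurable (fun ω ↦ B ω (Real.toNNReal q)) ℙ)
    (h41 : ∀ {A : Set ℂ}, IsStarHull A →
      ∀ {Φ : ConformalEquiv (upperHalfPlaneSet \ A) upperHalfPlaneSet}, IsRestrictionMap A Φ →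
        ∀ {d : ℝ}, HasRestrictionDeriv A Φ d →
          ℙ {ω | Disjoint (range (B ω)) A} = ENNReal.ofReal d) :
    LawlerSchrammWerner2003 ∧ LawlerSchrammWerner2003_unique :=
  LawlerSchrammWerner2003_and_unique_of_exists_one
    (exists_isRestrictionMeasure_of_chordalPath hpath hmk (α := 1) fun hA _ hΦ _ hd ↦ by
      rw [Real.rpow_one]; exact h41 hA hΦ hd)

end Literature.Probability.RandomPlanarGeometry

end
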